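import Summits.AtomisticToContinuum.Crystallization.Theorems.FrustratedLawDichotomyStrainedPatchHomExemptMove
import Summits.AtomisticToContinuum.Crystallization.Theorems.FrustratedLawDichotomyStrainedPatchHomLatticeBoxHcp

/-!
# The force/exempt prune in BOX form (sequel of `…StrainedPatchHomExemptMove`)

decomp-a2c hand-1 g26 (crux `AperiodicFrustratedLawGap`, stmt-AtomisticToContinuum-27623; `(H) HomFloor (1/625)`, hcp half; lever (C′) of critic
rows 1011 / 1019, memo `HOME/decomp-a2c-hand-1/g26/C2-MEMO-hand-1-g26.md`).  `…HomExemptMove` proved: slope bound along a one-atom move ⇒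
`MoveUnstableCore` ⇒ `ExemptNear (9/5) ExRec z c` (§1–§4), and the centre transfer of the local finset sum to a displacement-set `finsum` (§5).
Here (split off for the 400-line rule):

* §6 the label box for reference radius `10` (`[−11, 11]³`, both families) and ★★ `finsum_hcp_eq_boxSum` — the displacement-set `finsum` of ANY
  kernel vanishing from `‖v‖ ≥ 29/4` is the pair of explicit box sums (`‖G − 1‖ ≤ 1/4`, `‖ξ‖ ≤ 1/4`; `29/4·4/3 + 1/4 < 10`);
* §7 `dist_centre_gt_of_hcp_range` (every other site is `> 3/8` from the centre — no separation certificate needed for steps `s ≤ 3/8`) and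
  ★★★ `exemptNear_of_boxSlope` — THE REAL-SIDE STATEMENT A BOOLEAN `forceOut` LEAF REALISES: explicit box sums over `[−11,11]³` of the slope
  kernel `v ↦ 𝟙[v ≠ 0 ∧ ‖v‖ ≤ 7]·(‖τe − v‖⁻⁸ − ‖τe − v‖⁻¹⁴)·⟪τe − v, e⟫` at the two hcp families, `≤ −b` for `τ ∈ [0, s]`, plus the slack
  inequality `s(7/(7−s))⁷S₇♯(7) < b s`, give the `hver` prune disjunct `ExemptNear (9/5) ExRec z c` of `…HomEntryFlipHcp.hcpHalf_of_entryTreeShuf`.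

NO definitions; 0 sorry; standard axioms; no instances / notation / `#eval`.  `--supports stmt-AtomisticToContinuum-27623`.
-/

noncomputable section

namespace Summit.AtomisticToContinuum.Crystallization.Theorems.FrustratedLawDichotomyStrainedPatchHomExemptMove

open scoped BigOperators RealInnerProductSpace
open Literature.MathematicalPhysics.StatisticalMechanics (lennardJones)
open Summit.AtomisticToContinuum.Crystallization.Theorems.ChargedEnergyGapNegative (E3)
open Summit.AtomisticToContinuum.Crystallization.Theorems.FrustratedLawDichotomyExemptAbsorption (ExemptNear)
open Summit.AtomisticToContinuum.Crystallization.Theorems.FrustratedLawDichotomyStrainedPatchHomSplit (ExRec latPt hexFrame hcpShift)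
open Summit.AtomisticToContinuum.Crystallization.Theorems.FrustratedLawDichotomyStrainedPatchHomLatticeBox
  (norm_apply_ge_of_near_one latPt_zero)
open Summit.AtomisticToContinuum.Crystallization.Theorems.FrustratedLawDichotomyStrainedPatchHomLatticeBoxHcp
  (latPt_eq_apply_one norm_sq_hexPt norm_sq_hexPt_add_shift one_le_norm_sq_hexPt latPt_hex_injective shifted_eq_apply norm_shifted_gt
   shifted_ne_unshifted)

/-! ## §6. The label box for radius `29/4` (`‖G − 1‖ ≤ 1/4` ⇒ reference radius `< 10` ⇒ box `[−11, 11]³`) and the enumeration lemma -/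

/-- Integer bookkeeping: real bounds `−12 < n < 12` put `n` in `[−11, 11]`. [arithmetic] -/
theorem mem_Icc_eleven_of_bounds {n : ℤ} (h1 : ((n : ℤ) : ℝ) < 12) (h2 : (-12 : ℝ) < n) : n ∈ Finset.Icc (-11 : ℤ) 11 := by
  have h1' : n < 12 := by exact_mod_cast h1
  have h2' : -12 < n := by exact_mod_cast h2
  exact Finset.mem_Icc.2 ⟨by omega, by omega⟩

/-- ★ **Box, unshifted family, radius 10**: `‖P b‖ < 10 ⟹ b ∈ [−11, 11]³`. [folklore] -/
theorem mem_box11_of_norm_hexPt_lt {b : Fin 3 → ℤ} (hb : ‖latPt 1 hexFrame b‖ < 10) :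
    b ∈ Fintype.piFinset fun _ : Fin 3 => Finset.Icc (-11 : ℤ) 11 := by
  have hn := norm_nonneg (latPt 1 hexFrame b)
  have hsq : ‖latPt 1 hexFrame b‖ ^ 2 < 100 := by nlinarith
  rw [norm_sq_hexPt] at hsq
  have h0u : ((b 0 : ℤ) : ℝ) < 12 := by nlinarith [sq_nonneg (((b 0 : ℤ) : ℝ) + 2 * b 1), sq_nonneg ((b 2 : ℤ) : ℝ), sq_nonneg (((b 0 : ℤ) : ℝ) - 12)]
  have h0l : (-12 : ℝ) < b 0 := by nlinarith [sq_nonneg (((b 0 : ℤ) : ℝ) + 2 * b 1), sq_nonneg ((b 2 : ℤ) : ℝ), sq_nonneg (((b 0 : ℤ) : ℝ) + 12)]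
  have h1u : ((b 1 : ℤ) : ℝ) < 12 := by nlinarith [sq_nonneg (2 * ((b 0 : ℤ) : ℝ) + b 1), sq_nonneg ((b 2 : ℤ) : ℝ), sq_nonneg (((b 1 : ℤ) : ℝ) - 12)]
  have h1l : (-12 : ℝ) < b 1 := by nlinarith [sq_nonneg (2 * ((b 0 : ℤ) : ℝ) + b 1), sq_nonneg ((b 2 : ℤ) : ℝ), sq_nonneg (((b 1 : ℤ) : ℝ) + 12)]
  have h2u : ((b 2 : ℤ) : ℝ) < 12 := by nlinarith [sq_nonneg (2 * ((b 0 : ℤ) : ℝ) + b 1), sq_nonneg ((b 1 : ℤ) : ℝ), sq_nonneg (((b 2 : ℤ) : ℝ) - 12)]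
  have h2l : (-12 : ℝ) < b 2 := by nlinarith [sq_nonneg (2 * ((b 0 : ℤ) : ℝ) + b 1), sq_nonneg ((b 1 : ℤ) : ℝ), sq_nonneg (((b 2 : ℤ) : ℝ) + 12)]
  have h0 := mem_Icc_eleven_of_bounds h0u h0l
  have h1 := mem_Icc_eleven_of_bounds h1u h1l
  have h2 := mem_Icc_eleven_of_bounds h2u h2l
  rw [Fintype.mem_piFinset]
  intro i
  fin_cases i <;> assumption

/-- ★ **Box, shifted family, radius 10**: `‖P b + hcpShift‖ < 10 ⟹ b ∈ [−11, 11]³`. [folklore] -/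
theorem mem_box11_of_norm_hexPt_add_shift_lt {b : Fin 3 → ℤ} (hb : ‖latPt 1 hexFrame b + hcpShift‖ < 10) :
    b ∈ Fintype.piFinset fun _ : Fin 3 => Finset.Icc (-11 : ℤ) 11 := by
  have hn := norm_nonneg (latPt 1 hexFrame b + hcpShift)
  have hsq : ‖latPt 1 hexFrame b + hcpShift‖ ^ 2 < 100 := by nlinarith
  rw [norm_sq_hexPt_add_shift] at hsq
  have h0u : ((b 0 : ℤ) : ℝ) < 12 := by
    nlinarith [sq_nonneg ((((b 0 : ℤ) : ℝ) + 1 / 3) / 2 + (b 1 + 1 / 3)), sq_nonneg (((b 2 : ℤ) : ℝ) + 1 / 2), sq_nonneg (((b 0 : ℤ) : ℝ) - 12)]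
  have h0l : (-12 : ℝ) < b 0 := by
    nlinarith [sq_nonneg ((((b 0 : ℤ) : ℝ) + 1 / 3) / 2 + (b 1 + 1 / 3)), sq_nonneg (((b 2 : ℤ) : ℝ) + 1 / 2), sq_nonneg (((b 0 : ℤ) : ℝ) + 12)]
  have h1u : ((b 1 : ℤ) : ℝ) < 12 := by
    nlinarith [sq_nonneg (((b 0 : ℤ) : ℝ) + b 1 / 2 + 1 / 2), sq_nonneg (((b 2 : ℤ) : ℝ) + 1 / 2), sq_nonneg (((b 1 : ℤ) : ℝ) - 12)]
  have h1l : (-12 : ℝ) < b 1 := by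
    nlinarith [sq_nonneg (((b 0 : ℤ) : ℝ) + b 1 / 2 + 1 / 2), sq_nonneg (((b 2 : ℤ) : ℝ) + 1 / 2), sq_nonneg (((b 1 : ℤ) : ℝ) + 12)]
  have h2u : ((b 2 : ℤ) : ℝ) < 12 := by
    nlinarith [sq_nonneg (((b 0 : ℤ) : ℝ) + b 1 / 2 + 1 / 2), sq_nonneg (((b 1 : ℤ) : ℝ) + 1 / 3), sq_nonneg (((b 2 : ℤ) : ℝ) - 12)]
  have h2l : (-12 : ℝ) < b 2 := by
    nlinarith [sq_nonneg (((b 0 : ℤ) : ℝ) + b 1 / 2 + 1 / 2), sq_nonneg (((b 1 : ℤ) : ℝ) + 1 / 3), sq_nonneg (((b 2 : ℤ) : ℝ) + 12)]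
  have h0 := mem_Icc_eleven_of_bounds h0u h0l
  have h1 := mem_Icc_eleven_of_bounds h1u h1l
  have h2 := mem_Icc_eleven_of_bounds h2u h2l
  rw [Fintype.mem_piFinset]
  intro i
  fin_cases i <;> assumption

/-- ★★ **INDEX-BOX ENUMERATION, hcp, radius `29/4`** (`‖G − 1‖ ≤ 1/4`, `‖ξ‖ ≤ 1/4`, any kernel `g` vanishing from `‖v‖ ≥ 29/4` on):
`∑ᶠ v ∈ T, g v = Σ_{b ∈ [−11,11]³} g (latPt G hexFrame b) + Σ_{b ∈ [−11,11]³} g (latPt G hexFrame b + G (hcpShift + ξ))`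
(`T` = the displacement set of `localSum_centre_eq_finsum_hcp`; the two families are disjoint and injective; `29/4·4/3 + 1/4 < 10`). [folklore] -/
theorem finsum_hcp_eq_boxSum {G : E3 →L[ℝ] E3} {ξ : E3} (hG : ‖G - 1‖ ≤ 1 / 4) (hξ : ‖ξ‖ ≤ 1 / 4) (g : E3 → ℝ)
    (hg : ∀ v : E3, 29 / 4 ≤ ‖v‖ → g v = 0) :
    ∑ᶠ v ∈ {v : E3 | ∃ b : Fin 3 → ℤ, v = latPt G hexFrame b ∨ v = latPt G hexFrame b + G (hcpShift + ξ)}, g v =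
      ∑ b ∈ (Fintype.piFinset fun _ : Fin 3 => Finset.Icc (-11 : ℤ) 11), g (latPt G hexFrame b) +
        ∑ b ∈ (Fintype.piFinset fun _ : Fin 3 => Finset.Icc (-11 : ℤ) 11), g (latPt G hexFrame b + G (hcpShift + ξ)) := by
  classical
  set box : Finset (Fin 3 → ℤ) := Fintype.piFinset fun _ : Fin 3 => Finset.Icc (-11 : ℤ) 11 with hbox
  set F₁ : Finset E3 := box.image (latPt G hexFrame) with hF₁
  set F₂ : Finset E3 := box.image (fun b => latPt G hexFrame b + G (hcpShift + ξ)) with hF₂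
  have hinj := latPt_hex_injective hG
  have hinj₂ : Function.Injective (fun b : Fin 3 → ℤ => latPt G hexFrame b + G (hcpShift + ξ)) :=
    fun a b h => hinj (add_right_cancel h)
  rw [finsum_mem_inter_support_eq' g
    {v : E3 | ∃ b : Fin 3 → ℤ, v = latPt G hexFrame b ∨ v = latPt G hexFrame b + G (hcpShift + ξ)} (↑(F₁ ∪ F₂)) ?_]
  · rw [finsum_mem_coe_finset, Finset.sum_union, Finset.sum_image fun a _ b _ h => hinj h,
      Finset.sum_image fun a _ b _ h => hinj₂ h]
    rw [Finset.disjoint_left]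
    intro v hv1 hv2
    obtain ⟨b', -, rfl⟩ := Finset.mem_image.1 hv1
    obtain ⟨b, -, hb⟩ := Finset.mem_image.1 hv2
    exact shifted_ne_unshifted hG hξ b b' hb
  · intro v hv
    have hlt : ‖v‖ < 29 / 4 := lt_of_not_ge fun h => hv (hg _ h)
    simp only [Finset.coe_union, Set.mem_union, Finset.mem_coe, Set.mem_setOf_eq]
    constructor
    · rintro ⟨b, h | h⟩
      · refine Or.inl (Finset.mem_image.2 ⟨b, ?_, h.symm⟩)
        have h34 := norm_apply_ge_of_near_one hG (latPt 1 hexFrame b)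
        rw [← latPt_eq_apply_one, ← h] at h34
        exact mem_box11_of_norm_hexPt_lt (by linarith)
      · refine Or.inr (Finset.mem_image.2 ⟨b, ?_, h.symm⟩)
        have h34 := norm_apply_ge_of_near_one hG (latPt 1 hexFrame b + hcpShift + ξ)
        rw [← shifted_eq_apply, ← h] at h34
        have htri : ‖latPt 1 hexFrame b + hcpShift‖ ≤ ‖latPt 1 hexFrame b + hcpShift + ξ‖ + ‖ξ‖ := by
          calc ‖latPt 1 hexFrame b + hcpShift‖ = ‖(latPt 1 hexFrame b + hcpShift + ξ) - ξ‖ := by rw [add_sub_cancel_right]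
            _ ≤ ‖latPt 1 hexFrame b + hcpShift + ξ‖ + ‖ξ‖ := norm_sub_le _ _
        exact mem_box11_of_norm_hexPt_add_shift_lt (by linarith)
    · rintro (h1 | h2)
      · obtain ⟨b, -, rfl⟩ := Finset.mem_image.1 h1
        exact ⟨b, Or.inl rfl⟩
      · obtain ⟨b, -, rfl⟩ := Finset.mem_image.1 h2
        exact ⟨b, Or.inr rfl⟩

/-! ## §7. ★★★ The force/exempt prune in BOX form -/

/-- Other sites of the homogeneous hcp ball are farther than `3/8` from the centre (`‖U − 1‖ ≤ 1/4`, `‖ξ‖ ≤ 1/4`): unshifted displacements have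
norm `≥ 3/4`, shifted ones `> 3/8`.  (So one-atom moves of step `s ≤ 3/8` hit nobody — no separation certificate is needed.) [folklore] -/
theorem dist_centre_gt_of_hcp_range {M : ℕ} {z : Fin M → E3} {c : Fin M} (hz : Function.Injective z) {U : E3 →L[ℝ] E3} {ξ : E3}
    (hU : ‖U - 1‖ ≤ 1 / 4) (hξ : ‖ξ‖ ≤ 1 / 4)
    (hrange : Set.range z = {x : E3 | dist x (z c) ≤ 133 / 10 ∧ ∃ a : Fin 3 → ℤ,
      x = z c + latPt U hexFrame a ∨ x = z c + latPt U hexFrame a + U (hcpShift + ξ)})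
    {k : Fin M} (hk : k ≠ c) : 3 / 8 < dist (z k) (z c) := by
  have hmem : z k ∈ Set.range z := ⟨k, rfl⟩
  rw [hrange] at hmem
  obtain ⟨-, a, ha | ha⟩ := hmem
  · have ha0 : a ≠ 0 := by
      rintro rfl
      rw [latPt_zero, add_zero] at ha
      exact hk (hz ha)
    have h1 := one_le_norm_sq_hexPt ha0
    have h1' : 1 ≤ ‖latPt 1 hexFrame a‖ := by nlinarith [norm_nonneg (latPt 1 hexFrame a)]
    have h34 := norm_apply_ge_of_near_one hU (latPt 1 hexFrame a)
    rw [← latPt_eq_apply_one] at h34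
    rw [dist_eq_norm, ha, add_sub_cancel_left]
    linarith
  · rw [dist_eq_norm, ha, add_assoc, add_sub_cancel_left]
    exact norm_shifted_gt hU hξ a

/-- ★★★ **FORCE/EXEMPT PRUNE, BOX FORM** — the statement a Boolean `forceOut` leaf realises.  For the homogeneous hcp `133/10`-ball with data
`(U, ξ)` (`‖U − 1‖ ≤ 1/4`, `‖ξ‖ ≤ 1/4`, the `hver` range hypothesis), a direction `e` (`‖e‖ ≤ 1`), a step `0 < s ≤ 3/8` and a slope margin `b`
with `s·(7/(7−s))⁷·S₇♯(7) < b·s`: if for every `τ ∈ [0, s]` the EXPLICIT BOX SUMS over `[−11,11]³` of the slope kernel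
`v ↦ 𝟙[v ≠ 0 ∧ ‖v‖ ≤ 7]·(‖τe − v‖⁻⁸ − ‖τe − v‖⁻¹⁴)·⟪τe − v, e⟫` at `v = latPt U hexFrame b` and at `v = latPt U hexFrame b + U(hcpShift + ξ)` total
`≤ −b`, then `ExemptNear (9/5) ExRec z c` — the prune disjunct of `…HomEntryFlipHcp.hcpHalf_of_entryTreeShuf`'s `hver`. [folklore chaining:
§4 + §5 + §6 + `dist_centre_gt_of_hcp_range`] -/
theorem exemptNear_of_boxSlope {M : ℕ} {z : Fin M → E3} {c : Fin M} (hz : Function.Injective z) {U : E3 →L[ℝ] E3} {ξ : E3}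
    (hU : ‖U - 1‖ ≤ 1 / 4) (hξ : ‖ξ‖ ≤ 1 / 4)
    (hrange : Set.range z = {x : E3 | dist x (z c) ≤ 133 / 10 ∧ ∃ a : Fin 3 → ℤ,
      x = z c + latPt U hexFrame a ∨ x = z c + latPt U hexFrame a + U (hcpShift + ξ)})
    (e : E3) (he : ‖e‖ ≤ 1) {s b : ℝ} (hs0 : 0 < s) (hs38 : s ≤ 3 / 8)
    (hslope : ∀ τ ∈ Set.Icc (0 : ℝ) s,
      ∑ bb ∈ (Fintype.piFinset fun _ : Fin 3 => Finset.Icc (-11 : ℤ) 11),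
          (if latPt U hexFrame bb ≠ 0 ∧ ‖latPt U hexFrame bb‖ ≤ 7 then
            ((‖τ • e - latPt U hexFrame bb‖⁻¹) ^ 8 - (‖τ • e - latPt U hexFrame bb‖⁻¹) ^ 14) * ⟪τ • e - latPt U hexFrame bb, e⟫ else 0) +
        ∑ bb ∈ (Fintype.piFinset fun _ : Fin 3 => Finset.Icc (-11 : ℤ) 11),
          (if latPt U hexFrame bb + U (hcpShift + ξ) ≠ 0 ∧ ‖latPt U hexFrame bb + U (hcpShift + ξ)‖ ≤ 7 then
            ((‖τ • e - (latPt U hexFrame bb + U (hcpShift + ξ))‖⁻¹) ^ 8 - (‖τ • e - (latPt U hexFrame bb + U (hcpShift + ξ))‖⁻¹) ^ 14) *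
              ⟪τ • e - (latPt U hexFrame bb + U (hcpShift + ξ)), e⟫ else 0) ≤ -b)
    (hb : s * (7 / (7 - s)) ^ 7 * (6000 / 343 * (7 : ℝ)⁻¹ ^ 4 + 2880 / 49 * (7 : ℝ)⁻¹ ^ 5 + 10 / 7 * (7 : ℝ)⁻¹ ^ 6 + 2 * (7 : ℝ)⁻¹ ^ 7) < b * s) :
    ExemptNear (9 / 5) ExRec z c := by
  classical
  refine exemptNear_of_slope e he hs0 (by linarith) (fun k hk => lt_of_le_of_lt hs38 (dist_centre_gt_of_hcp_range hz hU hξ hrange hk))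
    (fun τ hτ => ?_) hb
  -- the slope kernel at parameter τ, as a function of the displacement `v = z k − z c`
  set g : E3 → ℝ := fun v => if v ≠ 0 ∧ ‖v‖ ≤ 7 then ((‖τ • e - v‖⁻¹) ^ 8 - (‖τ • e - v‖⁻¹) ^ 14) * ⟪τ • e - v, e⟫ else 0 with hg
  have hg0 : ∀ v : E3, 29 / 4 ≤ ‖v‖ → g v = 0 := by
    intro v hv
    have : ¬(v ≠ 0 ∧ ‖v‖ ≤ 7) := fun h => by linarith [h.2]
    simp [hg, this]
  -- (1) rewrite the local finset sum through the displacement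
  have h1 : ∑ k ∈ (Finset.univ.erase c).filter (fun k => dist (z k) (z c) ≤ 7),
      ((‖z c + τ • e - z k‖⁻¹) ^ 8 - (‖z c + τ • e - z k‖⁻¹) ^ 14) * ⟪z c + τ • e - z k, e⟫ =
      ∑ k ∈ (Finset.univ.erase c).filter (fun k => dist (z k) (z c) ≤ 7),
        (fun v : E3 => ((‖τ • e - v‖⁻¹) ^ 8 - (‖τ • e - v‖⁻¹) ^ 14) * ⟪τ • e - v, e⟫) (z k - z c) := by
    refine Finset.sum_congr rfl fun k _ => ?_
    have : z c + τ • e - z k = τ • e - (z k - z c) := by abel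
    simp only [this]
  -- (2) centre transfer (§5) and box enumeration (§6)
  have h2 := localSum_centre_eq_finsum_hcp hz hrange (Rm := 7) (by norm_num)
    (fun v : E3 => ((‖τ • e - v‖⁻¹) ^ 8 - (‖τ • e - v‖⁻¹) ^ 14) * ⟪τ • e - v, e⟫)
  have h3 := finsum_hcp_eq_boxSum hU hξ g hg0
  rw [h1, h2]
  show ∑ᶠ v ∈ {v : E3 | ∃ b : Fin 3 → ℤ, v = latPt U hexFrame b ∨ v = latPt U hexFrame b + U (hcpShift + ξ)}, g v ≤ -b
  rw [h3]
  exact hslope τ hτ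

end Summit.AtomisticToContinuum.Crystallization.Theorems.FrustratedLawDichotomyStrainedPatchHomExemptMove

end
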